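import Literature.AlgebraicGeometry.Morphisms.OpenGluing
import Literature.AlgebraicGeometry.Resolution.ResolutionOfSingularities
import Literature.AlgebraicGeometry.Resolution.BlowupsFlatBaseChange
import Literature.AlgebraicGeometry.Resolution.CompletedPullbackRegular
import Mathlib.AlgebraicGeometry.PullbackCarrier
import HarnessLib

/-!
# Gluing a proper modification of an open piece to the rest of the scheme

Topic: `Literature/AlgebraicGeometry/Resolution`. The gluing step of Zariski's patching in the
form used for one morphism of proper models (Zariski 1944; Piltant 2013, proof of Prop. 5.1,
Step 5: "glue along … to a proper model"), as pure scheme theory over Mathlib and the named fact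
`OpenGluing` (`Literature/AlgebraicGeometry/Morphisms/OpenGluing.lean`, Stacks 01LH with two
pieces). Data: a scheme `X`, two opens `V, Wc ⊆ X`, a proper `π : Yv → V` which is an
isomorphism over the open `W = V ∩ Wc` of `V` (`V.ι ⁻¹ᵁ Wc = W`). Inside the open subscheme
`O := V ∪ Wc` the opens `V' := O ∩ V ≅ V` and `W' := O ∩ Wc` cover, and `OpenGluing` glues
`Yv → V ≅ V'` to `W'` along `V' ∩ W'`; we read off the properties of the glued `ρ : N → O`:

* `isIntegral_of_range_union_opens` — a scheme covered by the range of an open immersion from an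
  integral scheme and an integral open meeting it is integral (stalkwise reducedness; the open is
  irreducible and dense).
* `glue_ρ_i_val`, `glue_exists_eq_i`, `glue_cover`, `glue_meet` — point bookkeeping through the
  cartesian square `Yv = N ×_O V'` (`Scheme.exists_preimage_of_isPullback`).
* `glue_isIntegral`, `glue_isBirational` — `N` is integral (for `X`, `Yv` integral and `W ≠ ∅`)
  and `ρ` is birational (an isomorphism over the dense open `W'` with dense preimage).
* `glue_isRegularLocalRing_iff`, `glue_isRegularLocalRing_of_mem` — over `Wc` the local rings of
  `N` are those of `X`; over `V` they are local rings of `Yv`.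
* `exists_glue_of_openGluing` — the package: `OpenGluing` gives `N`, a proper birational
  `ρ : N → V ∪ Wc` with `N` integral, regular over the regular points of `Wc` and regular over `V`
  when `Yv` is regular.

The choice of `Wc` (the complement of the closure of `Sing V`, `SingularLocusClosure.lean`) and
the model-theoretic wrapper are elsewhere; nothing here mentions models or resolutions.

## References

* The Stacks Project, Tag 01LH (relative gluing). [StacksProject]
* O. Piltant, *An axiomatic version of Zariski's patching theorem*, RACSAM 107 (2013),
  proof of Prop. 5.1, Step 5. [Piltant2013]
-/

noncomputable section

open CategoryTheory AlgebraicGeometry TopologicalSpace Topology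

namespace Literature.AlgebraicGeometry.Resolution

universe u

/-! ## Integrality of a scheme covered by two integral open pieces which meet -/

/-- A scheme `N` which is the union of the range of an open immersion `i : Y → N` from an
integral scheme and of an integral open `U` whose preimage in `Y` is non-empty is integral:
it is reduced stalkwise, and irreducible because the irreducible open `U` is dense (its trace on
the irreducible `Y` is a non-empty open, hence dense in `Y`). [folklore] -/
theorem isIntegral_of_range_union_opens {Y N : Scheme.{u}} (i : Y ⟶ N) [IsOpenImmersion i]
    [IsIntegral Y] (U : N.Opens) [IsIntegral (U : Scheme.{u})]
    (hcov : ∀ n : N, n ∈ Set.range i ∨ n ∈ U)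
    (hmeet : ((i ⁻¹ᵁ U : Y.Opens) : Set Y).Nonempty) : IsIntegral N := by
  -- reducedness, stalkwise
  haveI : ∀ n : N, _root_.IsReduced (N.presheaf.stalk n) := fun n => by
    rcases hcov n with ⟨y, rfl⟩ | hn
    · exact isReduced_of_injective (asIso (i.stalkMap y)).commRingCatIsoToRingEquiv
        (asIso (i.stalkMap y)).commRingCatIsoToRingEquiv.injective
    · have e := (asIso (U.ι.stalkMap ⟨n, hn⟩)).commRingCatIsoToRingEquiv
      exact isReduced_of_injective e e.injective
  haveI : IsReduced N := isReduced_of_isReduced_stalk N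
  -- irreducibility: `U` is irreducible and dense
  have hU : IsIrreducible (U : Set N) := by
    rw [← Scheme.Opens.range_ι, ← Set.image_univ]
    exact (IrreducibleSpace.isIrreducible_univ _).image _ U.ι.continuous.continuousOn
  have hdense : closure (U : Set N) = Set.univ := by
    apply Set.eq_univ_of_forall
    intro n
    rcases hcov n with ⟨y, rfl⟩ | hn
    · have hd : Dense ((i ⁻¹ᵁ U : Y.Opens) : Set Y) := (i ⁻¹ᵁ U).2.dense hmeet
      exact i.continuous.closure_preimage_subset _ (hd y)
    · exact subset_closure hn
  haveI : IrreducibleSpace N := by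
    rw [irreducibleSpace_def]
    have := hU.closure
    rwa [hdense] at this
  exact isIntegral_of_irreducibleSpace_of_isReduced N

/-! ## Reading off the glued morphism -/

section ReadOff

variable {X : Scheme.{u}} {V Wc : X.Opens} {Yv N : Scheme.{u}}
  (π : Yv ⟶ V) (ρ : N ⟶ ↑(V ⊔ Wc)) (i : Yv ⟶ N)
  (hsq : IsPullback i (π ≫ (Scheme.Opens.isoOfLE (le_sup_left : V ≤ V ⊔ Wc)).inv) ρ
    ((V ⊔ Wc).ι ⁻¹ᵁ V).ι)

include hsq

/-- Along the glued square `i ≫ ρ = π ≫ (V ≅ V') ≫ V'.ι`, the points `ρ (i y)` and `π y` of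
`V ∪ Wc`, resp. `V`, are the same point of `X`. [folklore] -/
theorem glue_ρ_i_val (y : Yv) : (ρ (i y)).1 = (π y).1 := by
  have h1 : (i ≫ ρ) y = ((π ≫ (Scheme.Opens.isoOfLE (le_sup_left : V ≤ V ⊔ Wc)).inv) ≫
      ((V ⊔ Wc).ι ⁻¹ᵁ V).ι) y := by rw [hsq.w]
  have h2 : (ρ (i y)).1 = ((i ≫ ρ) ≫ (V ⊔ Wc).ι) y := by
    simp only [Scheme.Hom.comp_apply, Scheme.Opens.ι_apply]
  rw [h2, Scheme.Hom.comp_apply, h1, ← Scheme.Hom.comp_apply, Category.assoc, Category.assoc,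
    Scheme.Opens.isoOfLE_inv_ι, Scheme.Hom.comp_apply, Scheme.Opens.ι_apply]

/-- Points of `N` over `V` come from `Yv` (surjectivity of the comparison with the topological
fibre product, `Scheme.exists_preimage_of_isPullback`). [folklore] -/
theorem glue_exists_eq_i (n : N) (hn : (ρ n).1 ∈ V) : ∃ y : Yv, i y = n := by
  obtain ⟨y, hy, -⟩ := Scheme.exists_preimage_of_isPullback hsq n ⟨ρ n, hn⟩ rfl
  exact ⟨y, hy⟩

/-- Every point of `N` lies in the range of `i` or over `Wc`. [folklore] -/
theorem glue_cover (n : N) : n ∈ Set.range i ∨ n ∈ ρ ⁻¹ᵁ ((V ⊔ Wc).ι ⁻¹ᵁ Wc) := by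
  have h : (ρ n).1 ∈ V ⊔ Wc := (ρ n).2
  rcases Opens.mem_sup.mp h with hV | hW
  · obtain ⟨y, hy⟩ := glue_exists_eq_i π ρ i hsq n hV
    exact Or.inl ⟨y, hy⟩
  · exact Or.inr hW

variable {W : (V : Scheme.{u}).Opens} (hW : V.ι ⁻¹ᵁ Wc = W)
include hW

omit hsq in
/-- If `π` is an isomorphism over `W = V ∩ Wc ≠ ∅`, some point of `Yv` maps into `Wc`.
[folklore] -/
theorem glue_exists_mem_of_isIso [IsIso (π ∣_ W)] (hWne : (W : Set V).Nonempty) :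
    ∃ y : Yv, (π y).1 ∈ Wc := by
  obtain ⟨w, hw⟩ := hWne
  let z : ↑(π ⁻¹ᵁ W) := (inv (π ∣_ W)) ⟨w, hw⟩
  refine ⟨z.1, ?_⟩
  have hz : π z.1 ∈ W := z.2
  exact hW.ge hz

/-- The glued piece over `Wc` meets the image of `Yv`: the open `i⁻¹ ρ⁻¹ (W')` of `Yv` is
non-empty. [folklore] -/
theorem glue_meet [IsIso (π ∣_ W)] (hWne : (W : Set V).Nonempty) :
    ((i ⁻¹ᵁ (ρ ⁻¹ᵁ ((V ⊔ Wc).ι ⁻¹ᵁ Wc)) : Yv.Opens) : Set Yv).Nonempty := by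
  obtain ⟨y, hy⟩ := glue_exists_mem_of_isIso π hW hWne
  refine ⟨y, ?_⟩
  show (ρ (i y)).1 ∈ Wc
  rw [glue_ρ_i_val π ρ i hsq]
  exact hy

variable [IsIntegral X] [IsIntegral Yv] [IsOpenImmersion i] [IsIso (ρ ∣_ ((V ⊔ Wc).ι ⁻¹ᵁ Wc))]
  [IsIso (π ∣_ W)] (hWne : (W : Set V).Nonempty)
include hWne

/-- **The glued scheme is integral** (`X`, `Yv` integral, `W ≠ ∅`): `N` is the union of the
image of `Yv` and of `ρ⁻¹(W') ≅ W'`, a non-empty open of the integral `X`, and the two pieces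
meet over `W`. [folklore] -/
theorem glue_isIntegral : IsIntegral N := by
  obtain ⟨y, hy⟩ := glue_meet π ρ i hsq hW hWne
  haveI : Nonempty (↑(V ⊔ Wc) : Scheme.{u}) := ⟨ρ (i y)⟩
  haveI : IsIntegral (↑(V ⊔ Wc) : Scheme.{u}) := isIntegral_of_isOpenImmersion (V ⊔ Wc).ι
  haveI : Nonempty (↑((V ⊔ Wc).ι ⁻¹ᵁ Wc) : Scheme.{u}) := ⟨⟨ρ (i y), hy⟩⟩
  haveI : IsIntegral (↑((V ⊔ Wc).ι ⁻¹ᵁ Wc) : Scheme.{u}) :=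
    isIntegral_of_isOpenImmersion ((V ⊔ Wc).ι ⁻¹ᵁ Wc).ι
  haveI : Nonempty (↑(ρ ⁻¹ᵁ ((V ⊔ Wc).ι ⁻¹ᵁ Wc)) : Scheme.{u}) := ⟨⟨i y, hy⟩⟩
  haveI : IsIntegral (↑(ρ ⁻¹ᵁ ((V ⊔ Wc).ι ⁻¹ᵁ Wc)) : Scheme.{u}) :=
    isIntegral_of_isOpenImmersion (ρ ∣_ ((V ⊔ Wc).ι ⁻¹ᵁ Wc))
  exact isIntegral_of_range_union_opens i (ρ ⁻¹ᵁ ((V ⊔ Wc).ι ⁻¹ᵁ Wc)) (glue_cover π ρ i hsq)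
    ⟨y, hy⟩

/-- **The glued morphism is birational**: it is an isomorphism over the non-empty open `W'` of
the irreducible `V ∪ Wc`, whose preimage is a non-empty open of the irreducible `N`.
[folklore] -/
theorem glue_isBirational : IsBirational ρ := by
  obtain ⟨y, hy⟩ := glue_meet π ρ i hsq hW hWne
  haveI : IsIntegral N := glue_isIntegral π ρ i hsq hW hWne
  haveI : Nonempty (↑(V ⊔ Wc) : Scheme.{u}) := ⟨ρ (i y)⟩
  haveI : IsIntegral (↑(V ⊔ Wc) : Scheme.{u}) := isIntegral_of_isOpenImmersion (V ⊔ Wc).ι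
  refine ⟨(V ⊔ Wc).ι ⁻¹ᵁ Wc, ?_, ?_, inferInstance⟩
  · exact ((V ⊔ Wc).ι ⁻¹ᵁ Wc).2.dense ⟨ρ (i y), hy⟩
  · exact (ρ ⁻¹ᵁ ((V ⊔ Wc).ι ⁻¹ᵁ Wc)).2.dense ⟨i y, hy⟩

omit hW hWne

omit hsq [IsIntegral X] [IsIntegral Yv] [IsOpenImmersion i] [IsIso (π ∣_ W)] in
/-- **Over `Wc`, the local rings of `N` are those of `X`**: `ρ` is an isomorphism over `W'` and
`V ∪ Wc ↪ X` is an open immersion. [folklore] -/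
theorem glue_isRegularLocalRing_iff (n : N) (hn : (ρ n).1 ∈ Wc) :
    IsRegularLocalRing (N.presheaf.stalk n) ↔ IsRegularLocalRing (X.presheaf.stalk (ρ n).1) := by
  have h1 := mem_regularLocus_iff_of_isIso_morphismRestrict ρ ((V ⊔ Wc).ι ⁻¹ᵁ Wc) n hn
  simp only [Scheme.mem_regularLocus] at h1
  rw [h1]
  exact (isRegularLocalRing_stalk_iff_of_isOpenImmersion (V ⊔ Wc).ι (ρ n)).symm

omit [IsIntegral X] [IsIntegral Yv] [IsIso (π ∣_ W)] [IsIso (ρ ∣_ ((V ⊔ Wc).ι ⁻¹ᵁ Wc))] in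
/-- **Over `V`, the local rings of `N` are local rings of `Yv`**, hence regular if `Yv` is
regular. [folklore] -/
theorem glue_isRegularLocalRing_of_mem (hY : Scheme.IsRegular Yv) (n : N) (hn : (ρ n).1 ∈ V) :
    IsRegularLocalRing (N.presheaf.stalk n) := by
  obtain ⟨y, rfl⟩ := glue_exists_eq_i π ρ i hsq n hn
  exact (isRegularLocalRing_stalk_iff_of_isOpenImmersion i y).mpr (hY y)

end ReadOff

/-! ## The gluing -/

/-- Preimage bookkeeping: under `V ≅ V' = (V ∪ Wc) ∩ V`, the open `V' ∩ W'` of `V'` corresponds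
to `V ∩ Wc`. [folklore] -/
theorem isoOfLE_inv_preimage {X : Scheme.{u}} (V Wc : X.Opens) :
    (Scheme.Opens.isoOfLE (le_sup_left : V ≤ V ⊔ Wc)).inv ⁻¹ᵁ
      (((V ⊔ Wc).ι ⁻¹ᵁ V).ι ⁻¹ᵁ ((V ⊔ Wc).ι ⁻¹ᵁ Wc)) = V.ι ⁻¹ᵁ Wc := by
  rw [← Scheme.Hom.comp_preimage, ← Scheme.Hom.comp_preimage, Category.assoc,
    Scheme.Opens.isoOfLE_inv_ι]

/-- **Gluing a proper `Yv → V`, an isomorphism over `V ∩ Wc`, to `Wc`** (Zariski's patching,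
Piltant 2013, proof of Prop. 5.1, Step 5, via the named fact `OpenGluing`, Stacks 01LH): for
opens `V, Wc` of an integral scheme `X`, an integral `Yv` and a proper `π : Yv → V` which is an
isomorphism over the non-empty open `W` of `V` with `V.ι ⁻¹ᵁ Wc = W`, there are an integral
scheme `N` and a proper birational `ρ : N → V ∪ Wc` whose local rings over `Wc` are regular
where those of `X` are, and whose local rings over `V` are regular when `Yv` is regular.
[cite: Piltant2013, proof of Prop. 5.1, Step 5] -/
theorem exists_glue_of_openGluing (hOG : Literature.AlgebraicGeometry.Morphisms.OpenGluing.{u})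
    {X : Scheme.{u}} [IsIntegral X] (V Wc : X.Opens) {Yv : Scheme.{u}} [IsIntegral Yv]
    (π : Yv ⟶ V) [IsProper π] (hY : Scheme.IsRegular Yv) (W : (V : Scheme.{u}).Opens)
    (hWne : (W : Set V).Nonempty) (hW : V.ι ⁻¹ᵁ Wc = W) [IsIso (π ∣_ W)] :
    ∃ (N : Scheme.{u}) (ρ : N ⟶ ↑(V ⊔ Wc)), IsIntegral N ∧ IsProper ρ ∧ IsBirational ρ ∧
      (∀ n : N, (ρ n).1 ∈ Wc → IsRegularLocalRing (X.presheaf.stalk (ρ n).1) →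
        IsRegularLocalRing (N.presheaf.stalk n)) ∧
      (∀ n : N, (ρ n).1 ∈ V → IsRegularLocalRing (N.presheaf.stalk n)) := by
  have hcov : (V ⊔ Wc).ι ⁻¹ᵁ V ⊔ (V ⊔ Wc).ι ⁻¹ᵁ Wc = ⊤ := by
    rw [← Scheme.Hom.preimage_sup, Scheme.Opens.ι_preimage_self]
  have hiso : IsIso ((π ≫ (Scheme.Opens.isoOfLE (le_sup_left : V ≤ V ⊔ Wc)).inv) ∣_
      (((V ⊔ Wc).ι ⁻¹ᵁ V).ι ⁻¹ᵁ ((V ⊔ Wc).ι ⁻¹ᵁ Wc))) := by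
    rw [morphismRestrict_comp]
    have h : IsIso (π ∣_ (Scheme.Opens.isoOfLE (le_sup_left : V ≤ V ⊔ Wc)).inv ⁻¹ᵁ
        (((V ⊔ Wc).ι ⁻¹ᵁ V).ι ⁻¹ᵁ ((V ⊔ Wc).ι ⁻¹ᵁ Wc))) := by
      rw [isoOfLE_inv_preimage, hW]; infer_instance
    exact @IsIso.comp_isIso _ _ _ _ _ _ _ h inferInstance
  obtain ⟨N, ρ, i, hi, hsq, hρW, hprop⟩ := hOG _ ((V ⊔ Wc).ι ⁻¹ᵁ V) ((V ⊔ Wc).ι ⁻¹ᵁ Wc) hcov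
    Yv (π ≫ (Scheme.Opens.isoOfLE (le_sup_left : V ≤ V ⊔ Wc)).inv) hiso
  haveI := hi
  haveI := hρW
  haveI : IsProper ρ := hprop inferInstance
  exact ⟨N, ρ, glue_isIntegral π ρ i hsq hW hWne, inferInstance,
    glue_isBirational π ρ i hsq hW hWne,
    fun n hn h => (glue_isRegularLocalRing_iff ρ n hn).mpr h,
    fun n hn => glue_isRegularLocalRing_of_mem π ρ i hsq hY n hn⟩

end Literature.AlgebraicGeometry.Resolution

end
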